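import Literature.MathematicalPhysics.KineticTheory.HierarchyContinuityEstimates
import HarnessLib

/-!
# The global (dispersive) chain estimate for the hierarchies (CIP 1994 §4.5, (5.7)–(5.9))

Topic: MathematicalPhysics / KineticTheory. A brick of the convergence half of the named fact
`Literature.MathematicalPhysics.KineticTheory.illner_pulvirenti` (global validity of the
Boltzmann equation for a rare gas cloud in all space; Cercignani–Illner–Pulvirenti 1994
Thm 4.5.1, Step 3 of its proof; Illner–Pulvirenti 1986/1989).

`HierarchyContinuityEstimates.abs_duhamelChain_le_weighted` is the "piling" induction of the
SHORT-time theory (BGSR Lemma 4.2 / Lanford): kinetic-energy weights `e^{-b H(Z)}`, collision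
operators of constant cost `A`, and ordered time integrals giving `tⁿ/n!`. Step 3 of the proof
of CIP 1994 Thm 4.5.1 runs the same induction with two changes, which this file abstracts:

* the weights are *time dependent* — `w_{b,t}(Z) = Dsp_t(Z) e^{-b H(Z)}` with a dispersive
  factor `Dsp_t` (for the rare cloud `Dsp_t(Z_s) = e^{-β₀ I(T^{-t} Z_s)}`, `I(Z) = ∑ |x_i|²`,
  (5.4)) that the transports carry from time `τ` to time `t` (free flow: exactly; hard-sphere
  flow: as an inequality, CIP Lemma 4.2.3–4.2.4), hypothesis `htr`;
* the collision operators cost a *time-dependent* constant `A(τ)` (the dispersion decay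
  `C (1 + τ)^{-d}` of (5.6), `IllnerPulvirentiDispersionDecay`), hypothesis `hop`, so that the
  ordered time integrals give `(∫₀ᵗ A)ⁿ/n!` ((5.8)) — bounded uniformly in `t` when `∫₀^∞ A < ∞`.

Contents (theorems only):

* `integral_mul_pow_primitive_div_factorial` — the time-simplex identity
  `∫₀ᵗ A(τ) M(τ)ⁿ/n! dτ = M(t)ⁿ⁺¹/(n+1)!`, `M(t) = ∫₀ᵗ A` (fundamental theorem of calculus);
* `abs_duhamelChain_le_dispersive` — the abstract chain estimate: if the innermost slot obeys
  `|R 0 (s+n) τ| ≤ K w_{b₀+nδ, τ}` on `[0, T]` then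
  `|R n s t (Z)| ≤ K Λⁿ M(t)ⁿ/n! w_{b₀,t}(Z)` on `[0, T]`,
  `Λ = λ_m^{-d/2} (k_max λ_m^{-1/2} + (k_max/δ)^{1/2})` (the velocity-moment bookkeeping of BGSR,
  `sum_norm_mul_exp_neg_mul_configEnergy_le`, is unchanged);
* `abs_duhamelTerm_le_dispersive` — the specialisation to the Duhamel terms
  `Literature.Analysis.FluidPDE.duhamelTerm` with data bounded at time `0`.

No hard-sphere specifics enter: transports, operators and the dispersive factor are abstract,
exactly as in `abs_duhamelChain_le_weighted`; the concrete single-step estimates (the analogue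
of BGSR (4.11) with the travelling Maxwellian, CIP (5.2)–(5.6)) are supplied elsewhere.

## References

* C. Cercignani, R. Illner, M. Pulvirenti, *The Mathematical Theory of Dilute Gases*, Applied
  Mathematical Sciences 106, Springer (1994), §4.5, proof of Thm 4.5.1, Step 3, (5.1)–(5.9),
  pp. 88–90.
* R. Illner, M. Pulvirenti, *Global validity of the Boltzmann equation for a two-dimensional
  rare gas in vacuum*, Comm. Math. Phys. 105 (1986) 189–203; *Erratum and improved result*,
  Comm. Math. Phys. 121 (1989) 143–146.
* T. Bodineau, I. Gallagher, L. Saint-Raymond, Invent. Math. 203 (2016), §4.2, proof of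
  Lemma 4.2 (the short-time template).
-/

open MeasureTheory Metric Real Set Filter Topology
open scoped InnerProductSpace ENNReal Nat

namespace Literature.MathematicalPhysics.KineticTheory

noncomputable section

/-! ## The time simplex with a time-dependent cost -/

section Simplex

/-- **The ordered time integrals with a time-dependent cost** (CIP 1994 §4.5 (5.8)): for a
continuous cost `A` with primitive `M(t) = ∫₀ᵗ A`,
`∫₀ᵗ A(τ) M(τ)ⁿ/n! dτ = M(t)ⁿ⁺¹/(n+1)!` (fundamental theorem of calculus for `Mⁿ⁺¹/(n+1)!`).
Iterated, the `n`-fold ordered integral of `∏ A(t_j)` is `M(t)ⁿ/n!`. [cite: CIP1994, §4.5 (5.8)] -/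
theorem integral_mul_pow_primitive_div_factorial {A M : ℝ → ℝ} (hA : Continuous A)
    (hM : ∀ τ, M τ = ∫ σ in (0 : ℝ)..τ, A σ) (t : ℝ) (n : ℕ) :
    ∫ τ in (0 : ℝ)..t, A τ * M τ ^ n / n ! = M t ^ (n + 1) / (n + 1)! := by
  have hMfun : M = fun τ => ∫ σ in (0 : ℝ)..τ, A σ := funext hM
  have hMd : ∀ τ, HasDerivAt M (A τ) τ := fun τ => by
    rw [hMfun]
    exact (hA.integral_hasStrictDerivAt 0 τ).hasDerivAt
  have hMc : Continuous M := continuous_iff_continuousAt.2 fun τ => (hMd τ).continuousAt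
  have hF : ∀ τ, HasDerivAt (fun τ => M τ ^ (n + 1) / (n + 1)!) (A τ * M τ ^ n / n !) τ := by
    intro τ
    have h1 : HasDerivAt (fun x => M x ^ (n + 1))
        (((n + 1 : ℕ) : ℝ) * M τ ^ (n + 1 - 1) * A τ) τ := (hMd τ).fun_pow (n + 1)
    refine (h1.div_const ((n + 1)! : ℝ)).congr_deriv ?_
    rw [Nat.add_sub_cancel, Nat.factorial_succ, div_eq_div_iff (by positivity) (by positivity)]
    push_cast
    ring
  have hint : IntervalIntegrable (fun τ => A τ * M τ ^ n / n !) volume 0 t :=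
    ((hA.mul (hMc.pow n)).div_const _).intervalIntegrable _ _
  have h := intervalIntegral.integral_eq_sub_of_hasDerivAt (fun τ _ => hF τ) hint
  have hM0 : M 0 = 0 := by rw [hM]; simp
  rw [h, hM0, zero_pow (Nat.succ_ne_zero n), zero_div, sub_zero]

end Simplex

/-! ## Piling the inequalities with time-dependent weights and costs -/

section Chain

variable {d : Type*} [Fintype d] {X : Type*}

/-- **The global chain estimate of CIP 1994 Thm 4.5.1, Step 3, for an abstract Duhamel chain.**
Let the weights be `w_{b,t}(Z) = Dsp t s Z · e^{-b H_s(Z)}` with an abstract nonnegative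
dispersive factor `Dsp`. Assume: the transports carry the weights forward in time
(`htr`: `|g| ≤ K w_{b,τ}` implies `|T_s(t-τ) g| ≤ K w_{b,t}` for `0 ≤ τ ≤ t`; CIP (5.3) with
Lemma 4.2.3–4.2.4); the collision operators satisfy the single-step estimate with a continuous
nonnegative time-dependent cost `A(τ)` (`hop`; CIP (5.2)–(5.6)); and `R n s t` obeys the Duhamel
recursion `R (n+1) s t = ∫₀ᵗ T_s(t-τ) C_s (R n (s+1) τ) dτ`. If the innermost slot satisfies
`|R 0 (s+n) τ| ≤ K w_{b₀+nδ, τ}` for `τ ∈ [0, T]` (`λ_m ≤ b₀`, `K ≥ 0`, `s + n ≤ k_max + 1`), then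
for `t ∈ [0, T]`
`|R n s t (Z)| ≤ K Λⁿ M(t)ⁿ/n! w_{b₀,t}(Z)`, `M(t) = ∫₀ᵗ A`,
`Λ = λ_m^{-d/2} (k_max λ_m^{-1/2} + (k_max/δ)^{1/2})`: each collision operator costs `A(τ) Λ` and a
loss `δ` on the energy weight, the transports cost nothing, and the ordered time integrals give
`M(t)ⁿ/n!` (`integral_mul_pow_primitive_div_factorial`; CIP (5.7)–(5.9)). With `∫₀^∞ A < ∞`
the bound is uniform in time. [cite: CIP1994, §4.5 (5.7)–(5.9)] -/
theorem abs_duhamelChain_le_dispersive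
    {transport : (s : ℕ) → ℝ → (Literature.Analysis.FluidPDE.Config s d X → ℝ) →
      Literature.Analysis.FluidPDE.Config s d X → ℝ}
    {Dsp : ℝ → (s : ℕ) → Literature.Analysis.FluidPDE.Config s d X → ℝ}
    (hDsp : ∀ t s Z, 0 ≤ Dsp t s Z)
    (htr : ∀ (s : ℕ) (b τ t : ℝ), 0 ≤ τ → τ ≤ t →
      ∀ (g : Literature.Analysis.FluidPDE.Config s d X → ℝ) (K : ℝ), 0 ≤ K →
      (∀ Z, |g Z| ≤ K * (Dsp τ s Z * exp (-b * Literature.Analysis.FluidPDE.configEnergy Z))) →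
      ∀ Z, |transport s (t - τ) g Z| ≤
        K * (Dsp t s Z * exp (-b * Literature.Analysis.FluidPDE.configEnergy Z)))
    {op : (s : ℕ) → (Literature.Analysis.FluidPDE.Config (s + 1) d X → ℝ) →
      Literature.Analysis.FluidPDE.Config s d X → ℝ}
    {A : ℝ → ℝ} (hAc : Continuous A) (hA0 : ∀ τ, 0 ≤ A τ)
    (hop : ∀ (k : ℕ) (g : Literature.Analysis.FluidPDE.Config (k + 1) d X → ℝ) (K b τ : ℝ),
      0 < b → 0 ≤ K → 0 ≤ τ →
      (∀ Z, |g Z| ≤ K * (Dsp τ (k + 1) Z * exp (-b * Literature.Analysis.FluidPDE.configEnergy Z))) →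
      ∀ Z : Literature.Analysis.FluidPDE.Config k d X, |op k g Z| ≤
        A τ * (sqrt b ^ Fintype.card d)⁻¹ * (k * (sqrt b)⁻¹ + ∑ i, ‖(Z i).2‖) *
          (K * (Dsp τ k Z * exp (-b * Literature.Analysis.FluidPDE.configEnergy Z))))
    (R : ℕ → (s : ℕ) → ℝ → Literature.Analysis.FluidPDE.Config s d X → ℝ)
    (hR : ∀ (n s : ℕ) (t : ℝ) (Z : Literature.Analysis.FluidPDE.Config s d X),
      R (n + 1) s t Z = ∫ τ in (0 : ℝ)..t, transport s (t - τ) (op s (R n (s + 1) τ)) Z)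
    {T bm δ : ℝ} (hT : 0 ≤ T) (hbm : 0 < bm) (hδ : 0 < δ) (kmax : ℕ) :
    ∀ (n s m : ℕ), m = s + n → m ≤ kmax + 1 → ∀ {b₀ : ℝ}, bm ≤ b₀ → ∀ {K : ℝ}, 0 ≤ K →
      (∀ τ ∈ Icc 0 T, ∀ Z : Literature.Analysis.FluidPDE.Config m d X,
        |R 0 m τ Z| ≤ K * (Dsp τ m Z *
          exp (-(b₀ + n * δ) * Literature.Analysis.FluidPDE.configEnergy Z))) →
      ∀ t ∈ Icc 0 T, ∀ Z : Literature.Analysis.FluidPDE.Config s d X,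
        |R n s t Z| ≤
          K * ((sqrt bm ^ Fintype.card d)⁻¹ * (kmax * (sqrt bm)⁻¹ + sqrt (kmax / δ))) ^ n *
            (∫ σ in (0 : ℝ)..t, A σ) ^ n / n ! *
            (Dsp t s Z * exp (-b₀ * Literature.Analysis.FluidPDE.configEnergy Z)) := by
  have _ := hT
  set Λ := (sqrt bm ^ Fintype.card d)⁻¹ * (kmax * (sqrt bm)⁻¹ + sqrt (kmax / δ)) with hΛ
  -- the primitive of the cost, as an opaque function with its defining equations
  obtain ⟨M, hM⟩ : ∃ M : ℝ → ℝ, ∀ τ, M τ = ∫ σ in (0 : ℝ)..τ, A σ := ⟨_, fun τ => rfl⟩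
  have hsbm : 0 < sqrt bm := sqrt_pos.2 hbm
  have hΛ0 : 0 ≤ Λ := by positivity
  have hM0 : ∀ {t : ℝ}, 0 ≤ t → 0 ≤ M t := fun ht => by
    rw [hM]; exact intervalIntegral.integral_nonneg_of_forall ht hA0
  have hMc : Continuous M := by
    have hMfun : M = fun τ => ∫ σ in (0 : ℝ)..τ, A σ := funext hM
    rw [hMfun]
    exact continuous_iff_continuousAt.2 fun τ =>
      (hAc.integral_hasStrictDerivAt 0 τ).hasDerivAt.continuousAt
  intro n
  induction n with
  | zero =>
    intro s m hm _ b₀ _ K _ hin t ht Z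
    obtain rfl : m = s := by simpa using hm
    simpa using hin t ht Z
  | succ n ih =>
    intro s m hm hmk b₀ hb₀ K hK hin t ht Z
    have hsk : s ≤ kmax := by omega
    have hb₁ : 0 < b₀ + δ := by linarith
    -- the induction hypothesis at level `s + 1`, final weight `b₀ + δ`
    have hin' : ∀ τ ∈ Icc 0 T, ∀ Z : Literature.Analysis.FluidPDE.Config m d X,
        |R 0 m τ Z| ≤ K * (Dsp τ m Z *
          exp (-((b₀ + δ) + n * δ) * Literature.Analysis.FluidPDE.configEnergy Z)) := by
      intro τ hτ Z
      convert hin τ hτ Z using 4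
      push_cast
      ring
    have hIH := ih (s + 1) m (by omega) hmk (b₀ := b₀ + δ) (by linarith) hK hin'
    -- pointwise bound on the integrand of the last Duhamel integral
    have hpt : ∀ τ ∈ Ioc 0 t, ∀ Z : Literature.Analysis.FluidPDE.Config s d X,
        |transport s (t - τ) (op s (R n (s + 1) τ)) Z| ≤
          (A τ * Λ * (K * Λ ^ n * M τ ^ n / n !)) *
            (Dsp t s Z * exp (-b₀ * Literature.Analysis.FluidPDE.configEnergy Z)) := by
      intro τ hτ Z
      have hτ0 : 0 ≤ τ := hτ.1.le
      have hτT : τ ∈ Icc 0 T := ⟨hτ0, hτ.2.trans ht.2⟩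
      set Kτ := K * Λ ^ n * M τ ^ n / n ! with hKτ
      have hKτ0 : 0 ≤ Kτ := by
        have := hM0 hτ0
        positivity
      have hg : ∀ Z' : Literature.Analysis.FluidPDE.Config (s + 1) d X,
          |R n (s + 1) τ Z'| ≤ Kτ * (Dsp τ (s + 1) Z' *
            exp (-(b₀ + δ) * Literature.Analysis.FluidPDE.configEnergy Z')) := fun Z' => by
        have h := hIH τ hτT Z'
        rw [← hM τ] at h
        simpa only [hKτ] using h
      -- one collision operator costs `A τ * Λ` and the weight `δ`
      have hopτ : ∀ Z' : Literature.Analysis.FluidPDE.Config s d X,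
          |op s (R n (s + 1) τ) Z'| ≤ (A τ * Λ * Kτ) *
            (Dsp τ s Z' * exp (-b₀ * Literature.Analysis.FluidPDE.configEnergy Z')) := by
        intro Z'
        refine (hop s (R n (s + 1) τ) Kτ (b₀ + δ) τ hb₁ hKτ0 hτ0 hg Z').trans ?_
        have hsb : sqrt bm ≤ sqrt (b₀ + δ) := sqrt_le_sqrt (by linarith)
        have h1 : (sqrt (b₀ + δ) ^ Fintype.card d)⁻¹ ≤ (sqrt bm ^ Fintype.card d)⁻¹ := by
          apply inv_anti₀ (pow_pos hsbm _)
          exact pow_le_pow_left₀ hsbm.le hsb _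
        have h2 : (s * (sqrt (b₀ + δ))⁻¹ + ∑ i, ‖(Z' i).2‖) *
            exp (-δ * Literature.Analysis.FluidPDE.configEnergy Z') ≤
            kmax * (sqrt bm)⁻¹ + sqrt (kmax / δ) := by
          have hmom := sum_norm_mul_exp_neg_mul_configEnergy_le Z' hδ
          have hexp1 : exp (-δ * Literature.Analysis.FluidPDE.configEnergy Z') ≤ 1 := by
            apply exp_le_one_iff.2
            have : 0 ≤ Literature.Analysis.FluidPDE.configEnergy Z' := by
              unfold Literature.Analysis.FluidPDE.configEnergy; positivity
            nlinarith
          have hsk' : (s : ℝ) ≤ kmax := by exact_mod_cast hsk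
          have hinv : (sqrt (b₀ + δ))⁻¹ ≤ (sqrt bm)⁻¹ := inv_anti₀ hsbm hsb
          have hsq : sqrt (s / δ) ≤ sqrt (kmax / δ) := sqrt_le_sqrt (by gcongr)
          rw [add_mul]
          refine add_le_add ?_ (hmom.trans hsq)
          calc (s : ℝ) * (sqrt (b₀ + δ))⁻¹ * exp (-δ * Literature.Analysis.FluidPDE.configEnergy Z')
              ≤ (s : ℝ) * (sqrt (b₀ + δ))⁻¹ * 1 := by gcongr
            _ = (s : ℝ) * (sqrt (b₀ + δ))⁻¹ := mul_one _
            _ ≤ kmax * (sqrt bm)⁻¹ := by gcongr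
        have hexp : exp (-(b₀ + δ) * Literature.Analysis.FluidPDE.configEnergy Z') =
            exp (-δ * Literature.Analysis.FluidPDE.configEnergy Z') *
              exp (-b₀ * Literature.Analysis.FluidPDE.configEnergy Z') := by
          rw [← Real.exp_add]
          congr 1
          ring
        have hD0 := hDsp τ s Z'
        have hAτ := hA0 τ
        calc A τ * (sqrt (b₀ + δ) ^ Fintype.card d)⁻¹ * (s * (sqrt (b₀ + δ))⁻¹ + ∑ i, ‖(Z' i).2‖) *
              (Kτ * (Dsp τ s Z' * exp (-(b₀ + δ) * Literature.Analysis.FluidPDE.configEnergy Z')))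
            = A τ * (sqrt (b₀ + δ) ^ Fintype.card d)⁻¹ *
                ((s * (sqrt (b₀ + δ))⁻¹ + ∑ i, ‖(Z' i).2‖) *
                  exp (-δ * Literature.Analysis.FluidPDE.configEnergy Z')) *
                (Kτ * (Dsp τ s Z' * exp (-b₀ * Literature.Analysis.FluidPDE.configEnergy Z'))) := by
              rw [hexp]; ring
          _ ≤ A τ * (sqrt bm ^ Fintype.card d)⁻¹ * (kmax * (sqrt bm)⁻¹ + sqrt (kmax / δ)) *
                (Kτ * (Dsp τ s Z' * exp (-b₀ * Literature.Analysis.FluidPDE.configEnergy Z'))) := by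
              gcongr
          _ = (A τ * Λ * Kτ) *
                (Dsp τ s Z' * exp (-b₀ * Literature.Analysis.FluidPDE.configEnergy Z')) := by
              rw [hΛ]; ring
      -- the transport from `τ` to `t` costs nothing
      have hAK : 0 ≤ A τ * Λ * Kτ := by
        have := hA0 τ
        positivity
      exact htr s b₀ τ t hτ0 hτ.2 (op s (R n (s + 1) τ)) (A τ * Λ * Kτ) hAK hopτ Z
    -- integrate in time
    rw [hR, ← hM t]
    set W : ℝ := Dsp t s Z * exp (-b₀ * Literature.Analysis.FluidPDE.configEnergy Z) with hW
    have hcont : Continuous fun τ : ℝ => (A τ * Λ * (K * Λ ^ n * M τ ^ n / n !)) * W :=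
      (((hAc.mul continuous_const).mul
        (((continuous_const.mul (hMc.pow n)).div_const _))).mul continuous_const)
    have hle := intervalIntegral.norm_integral_le_of_norm_le ht.1
      (Eventually.of_forall fun τ hτ => (Real.norm_eq_abs _).le.trans (hpt τ hτ Z))
      (hcont.intervalIntegrable (μ := volume) 0 t)
    rw [Real.norm_eq_abs] at hle
    refine hle.trans_eq ?_
    have hfun : (fun τ : ℝ => (A τ * Λ * (K * Λ ^ n * M τ ^ n / n !)) * W) =
        fun τ : ℝ => (Λ * K * Λ ^ n * W) * (A τ * M τ ^ n / n !) := by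
      funext τ
      ring
    rw [hfun, intervalIntegral.integral_const_mul, integral_mul_pow_primitive_div_factorial hAc hM t n]
    ring

/-- **The global chain estimate for the Duhamel terms `Q_{s,s+n}(t) F₀`** (`duhamelTerm`,
innermost slot `T_{s+n}(τ) F₀^{(s+n)}`): under the hypotheses of
`abs_duhamelChain_le_dispersive` on the transports and collision operators, if the data obey
`|F₀^{(s+n)}(Z)| ≤ K Dsp 0 (s+n) Z · e^{-(λ₀ + nδ) H_{s+n}(Z)}` (time `0`), then for `t ≥ 0`
`|Q_{s,s+n}(t) F₀ (Z_s)| ≤ K Λⁿ M(t)ⁿ/n! · Dsp t s Z_s · e^{-λ₀ H_s(Z_s)}`, `M(t) = ∫₀ᵗ A`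
(CIP 1994 §4.5 (5.9), with the Stirling step left to the user as in the short-time file).
[cite: CIP1994, §4.5 (5.7)–(5.9)] -/
theorem abs_duhamelTerm_le_dispersive
    {transport : (s : ℕ) → ℝ → (Literature.Analysis.FluidPDE.Config s d X → ℝ) →
      Literature.Analysis.FluidPDE.Config s d X → ℝ}
    {Dsp : ℝ → (s : ℕ) → Literature.Analysis.FluidPDE.Config s d X → ℝ}
    (hDsp : ∀ t s Z, 0 ≤ Dsp t s Z)
    (htr : ∀ (s : ℕ) (b τ t : ℝ), 0 ≤ τ → τ ≤ t →
      ∀ (g : Literature.Analysis.FluidPDE.Config s d X → ℝ) (K : ℝ), 0 ≤ K →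
      (∀ Z, |g Z| ≤ K * (Dsp τ s Z * exp (-b * Literature.Analysis.FluidPDE.configEnergy Z))) →
      ∀ Z, |transport s (t - τ) g Z| ≤
        K * (Dsp t s Z * exp (-b * Literature.Analysis.FluidPDE.configEnergy Z)))
    {op : (s : ℕ) → (Literature.Analysis.FluidPDE.Config (s + 1) d X → ℝ) →
      Literature.Analysis.FluidPDE.Config s d X → ℝ}
    {A : ℝ → ℝ} (hAc : Continuous A) (hA0 : ∀ τ, 0 ≤ A τ)
    (hop : ∀ (k : ℕ) (g : Literature.Analysis.FluidPDE.Config (k + 1) d X → ℝ) (K b τ : ℝ),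
      0 < b → 0 ≤ K → 0 ≤ τ →
      (∀ Z, |g Z| ≤ K * (Dsp τ (k + 1) Z * exp (-b * Literature.Analysis.FluidPDE.configEnergy Z))) →
      ∀ Z : Literature.Analysis.FluidPDE.Config k d X, |op k g Z| ≤
        A τ * (sqrt b ^ Fintype.card d)⁻¹ * (k * (sqrt b)⁻¹ + ∑ i, ‖(Z i).2‖) *
          (K * (Dsp τ k Z * exp (-b * Literature.Analysis.FluidPDE.configEnergy Z))))
    {bm δ : ℝ} (hbm : 0 < bm) (hδ : 0 < δ) (kmax n s : ℕ) (hk : s + n ≤ kmax + 1)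
    {b₀ : ℝ} (hb₀ : bm ≤ b₀) {K : ℝ} (hK : 0 ≤ K) (F₀ : Literature.Analysis.FluidPDE.GCState d X)
    (hF : ∀ Z : Literature.Analysis.FluidPDE.Config (s + n) d X, |F₀ (s + n) Z| ≤
      K * (Dsp 0 (s + n) Z * exp (-(b₀ + n * δ) * Literature.Analysis.FluidPDE.configEnergy Z)))
    {t : ℝ} (ht : 0 ≤ t) (Z : Literature.Analysis.FluidPDE.Config s d X) :
    |Literature.Analysis.FluidPDE.duhamelTerm transport op n s t F₀ Z| ≤
      K * ((sqrt bm ^ Fintype.card d)⁻¹ * (kmax * (sqrt bm)⁻¹ + sqrt (kmax / δ))) ^ n *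
        (∫ σ in (0 : ℝ)..t, A σ) ^ n / n ! *
        (Dsp t s Z * exp (-b₀ * Literature.Analysis.FluidPDE.configEnergy Z)) := by
  refine abs_duhamelChain_le_dispersive hDsp htr hAc hA0 hop
    (fun n s t => Literature.Analysis.FluidPDE.duhamelTerm transport op n s t F₀)
    (fun n s t Z => Literature.Analysis.FluidPDE.duhamelTerm_succ transport op n s t F₀ Z)
    ht hbm hδ kmax n s (s + n) rfl hk hb₀ hK (fun τ hτ Z => ?_) t ⟨ht, le_rfl⟩ Z
  rw [Literature.Analysis.FluidPDE.duhamelTerm_zero]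
  have h := htr (s + n) (b₀ + n * δ) 0 τ le_rfl hτ.1 (F₀ (s + n)) K hK hF Z
  rwa [sub_zero] at h

end Chain

/-! ## The variants with a ceiling on the energy weights -/

section ChainCeiling

variable {d : Type*} [Fintype d] {X : Type*}

/-- **The global chain estimate with a ceiling on the energy weights.** The same statement
and proof as `abs_duhamelChain_le_dispersive`, except that the single-step estimate `hop` is
only required for energy weights `b ≤ b_max`, and accordingly the initial weight must satisfy
`b₀ + nδ ≤ b_max`. This is the form the rare-cloud estimates need: the dispersive cost of one
collision operator is `min(C_d b^{-d/2}, C (1+τ)^{-d})` (CIP 1994 §4.5 (5.6)), which is of the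
form `A(τ) b^{-d/2}` with a time-decaying `A` only on a bounded range of `b`.
[cite: CIP1994, §4.5 (5.7)–(5.9)] -/
theorem abs_duhamelChain_le_dispersive_of_le
    {transport : (s : ℕ) → ℝ → (Literature.Analysis.FluidPDE.Config s d X → ℝ) →
      Literature.Analysis.FluidPDE.Config s d X → ℝ}
    {Dsp : ℝ → (s : ℕ) → Literature.Analysis.FluidPDE.Config s d X → ℝ}
    (hDsp : ∀ t s Z, 0 ≤ Dsp t s Z)
    (htr : ∀ (s : ℕ) (b τ t : ℝ), 0 ≤ τ → τ ≤ t →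
      ∀ (g : Literature.Analysis.FluidPDE.Config s d X → ℝ) (K : ℝ), 0 ≤ K →
      (∀ Z, |g Z| ≤ K * (Dsp τ s Z * exp (-b * Literature.Analysis.FluidPDE.configEnergy Z))) →
      ∀ Z, |transport s (t - τ) g Z| ≤
        K * (Dsp t s Z * exp (-b * Literature.Analysis.FluidPDE.configEnergy Z)))
    {op : (s : ℕ) → (Literature.Analysis.FluidPDE.Config (s + 1) d X → ℝ) →
      Literature.Analysis.FluidPDE.Config s d X → ℝ}
    {A : ℝ → ℝ} (hAc : Continuous A) (hA0 : ∀ τ, 0 ≤ A τ) {bmax : ℝ}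
    (hop : ∀ (k : ℕ) (g : Literature.Analysis.FluidPDE.Config (k + 1) d X → ℝ) (K b τ : ℝ),
      0 < b → b ≤ bmax → 0 ≤ K → 0 ≤ τ →
      (∀ Z, |g Z| ≤ K * (Dsp τ (k + 1) Z * exp (-b * Literature.Analysis.FluidPDE.configEnergy Z))) →
      ∀ Z : Literature.Analysis.FluidPDE.Config k d X, |op k g Z| ≤
        A τ * (sqrt b ^ Fintype.card d)⁻¹ * (k * (sqrt b)⁻¹ + ∑ i, ‖(Z i).2‖) *
          (K * (Dsp τ k Z * exp (-b * Literature.Analysis.FluidPDE.configEnergy Z))))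
    (R : ℕ → (s : ℕ) → ℝ → Literature.Analysis.FluidPDE.Config s d X → ℝ)
    (hR : ∀ (n s : ℕ) (t : ℝ) (Z : Literature.Analysis.FluidPDE.Config s d X),
      R (n + 1) s t Z = ∫ τ in (0 : ℝ)..t, transport s (t - τ) (op s (R n (s + 1) τ)) Z)
    {T bm δ : ℝ} (hT : 0 ≤ T) (hbm : 0 < bm) (hδ : 0 < δ) (kmax : ℕ) :
    ∀ (n s m : ℕ), m = s + n → m ≤ kmax + 1 → ∀ {b₀ : ℝ}, bm ≤ b₀ → b₀ + n * δ ≤ bmax →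
      ∀ {K : ℝ}, 0 ≤ K →
      (∀ τ ∈ Icc 0 T, ∀ Z : Literature.Analysis.FluidPDE.Config m d X,
        |R 0 m τ Z| ≤ K * (Dsp τ m Z *
          exp (-(b₀ + n * δ) * Literature.Analysis.FluidPDE.configEnergy Z))) →
      ∀ t ∈ Icc 0 T, ∀ Z : Literature.Analysis.FluidPDE.Config s d X,
        |R n s t Z| ≤
          K * ((sqrt bm ^ Fintype.card d)⁻¹ * (kmax * (sqrt bm)⁻¹ + sqrt (kmax / δ))) ^ n *
            (∫ σ in (0 : ℝ)..t, A σ) ^ n / n ! *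
            (Dsp t s Z * exp (-b₀ * Literature.Analysis.FluidPDE.configEnergy Z)) := by
  have _ := hT
  set Λ := (sqrt bm ^ Fintype.card d)⁻¹ * (kmax * (sqrt bm)⁻¹ + sqrt (kmax / δ)) with hΛ
  -- the primitive of the cost, as an opaque function with its defining equations
  obtain ⟨M, hM⟩ : ∃ M : ℝ → ℝ, ∀ τ, M τ = ∫ σ in (0 : ℝ)..τ, A σ := ⟨_, fun τ => rfl⟩
  have hsbm : 0 < sqrt bm := sqrt_pos.2 hbm
  have hΛ0 : 0 ≤ Λ := by positivity
  have hM0 : ∀ {t : ℝ}, 0 ≤ t → 0 ≤ M t := fun ht => by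
    rw [hM]; exact intervalIntegral.integral_nonneg_of_forall ht hA0
  have hMc : Continuous M := by
    have hMfun : M = fun τ => ∫ σ in (0 : ℝ)..τ, A σ := funext hM
    rw [hMfun]
    exact continuous_iff_continuousAt.2 fun τ =>
      (hAc.integral_hasStrictDerivAt 0 τ).hasDerivAt.continuousAt
  intro n
  induction n with
  | zero =>
    intro s m hm _ b₀ _ _ K _ hin t ht Z
    obtain rfl : m = s := by simpa using hm
    simpa using hin t ht Z
  | succ n ih =>
    intro s m hm hmk b₀ hb₀ hbmax K hK hin t ht Z
    have hsk : s ≤ kmax := by omega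
    have hb₁ : 0 < b₀ + δ := by linarith
    have hnδ : (0 : ℝ) ≤ n * δ := by positivity
    have hbmax₁ : b₀ + δ ≤ bmax := by push_cast at hbmax; nlinarith
    have hbmax' : (b₀ + δ) + n * δ ≤ bmax := by push_cast at hbmax; linarith
    -- the induction hypothesis at level `s + 1`, final weight `b₀ + δ`
    have hin' : ∀ τ ∈ Icc 0 T, ∀ Z : Literature.Analysis.FluidPDE.Config m d X,
        |R 0 m τ Z| ≤ K * (Dsp τ m Z *
          exp (-((b₀ + δ) + n * δ) * Literature.Analysis.FluidPDE.configEnergy Z)) := by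
      intro τ hτ Z
      convert hin τ hτ Z using 4
      push_cast
      ring
    have hIH := ih (s + 1) m (by omega) hmk (b₀ := b₀ + δ) (by linarith) hbmax' hK hin'
    -- pointwise bound on the integrand of the last Duhamel integral
    have hpt : ∀ τ ∈ Ioc 0 t, ∀ Z : Literature.Analysis.FluidPDE.Config s d X,
        |transport s (t - τ) (op s (R n (s + 1) τ)) Z| ≤
          (A τ * Λ * (K * Λ ^ n * M τ ^ n / n !)) *
            (Dsp t s Z * exp (-b₀ * Literature.Analysis.FluidPDE.configEnergy Z)) := by
      intro τ hτ Z
      have hτ0 : 0 ≤ τ := hτ.1.le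
      have hτT : τ ∈ Icc 0 T := ⟨hτ0, hτ.2.trans ht.2⟩
      set Kτ := K * Λ ^ n * M τ ^ n / n ! with hKτ
      have hKτ0 : 0 ≤ Kτ := by
        have := hM0 hτ0
        positivity
      have hg : ∀ Z' : Literature.Analysis.FluidPDE.Config (s + 1) d X,
          |R n (s + 1) τ Z'| ≤ Kτ * (Dsp τ (s + 1) Z' *
            exp (-(b₀ + δ) * Literature.Analysis.FluidPDE.configEnergy Z')) := fun Z' => by
        have h := hIH τ hτT Z'
        rw [← hM τ] at h
        simpa only [hKτ] using h
      -- one collision operator costs `A τ * Λ` and the weight `δ`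
      have hopτ : ∀ Z' : Literature.Analysis.FluidPDE.Config s d X,
          |op s (R n (s + 1) τ) Z'| ≤ (A τ * Λ * Kτ) *
            (Dsp τ s Z' * exp (-b₀ * Literature.Analysis.FluidPDE.configEnergy Z')) := by
        intro Z'
        refine (hop s (R n (s + 1) τ) Kτ (b₀ + δ) τ hb₁ hbmax₁ hKτ0 hτ0 hg Z').trans ?_
        have hsb : sqrt bm ≤ sqrt (b₀ + δ) := sqrt_le_sqrt (by linarith)
        have h1 : (sqrt (b₀ + δ) ^ Fintype.card d)⁻¹ ≤ (sqrt bm ^ Fintype.card d)⁻¹ := by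
          apply inv_anti₀ (pow_pos hsbm _)
          exact pow_le_pow_left₀ hsbm.le hsb _
        have h2 : (s * (sqrt (b₀ + δ))⁻¹ + ∑ i, ‖(Z' i).2‖) *
            exp (-δ * Literature.Analysis.FluidPDE.configEnergy Z') ≤
            kmax * (sqrt bm)⁻¹ + sqrt (kmax / δ) := by
          have hmom := sum_norm_mul_exp_neg_mul_configEnergy_le Z' hδ
          have hexp1 : exp (-δ * Literature.Analysis.FluidPDE.configEnergy Z') ≤ 1 := by
            apply exp_le_one_iff.2
            have : 0 ≤ Literature.Analysis.FluidPDE.configEnergy Z' := by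
              unfold Literature.Analysis.FluidPDE.configEnergy; positivity
            nlinarith
          have hsk' : (s : ℝ) ≤ kmax := by exact_mod_cast hsk
          have hinv : (sqrt (b₀ + δ))⁻¹ ≤ (sqrt bm)⁻¹ := inv_anti₀ hsbm hsb
          have hsq : sqrt (s / δ) ≤ sqrt (kmax / δ) := sqrt_le_sqrt (by gcongr)
          rw [add_mul]
          refine add_le_add ?_ (hmom.trans hsq)
          calc (s : ℝ) * (sqrt (b₀ + δ))⁻¹ * exp (-δ * Literature.Analysis.FluidPDE.configEnergy Z')
              ≤ (s : ℝ) * (sqrt (b₀ + δ))⁻¹ * 1 := by gcongr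
            _ = (s : ℝ) * (sqrt (b₀ + δ))⁻¹ := mul_one _
            _ ≤ kmax * (sqrt bm)⁻¹ := by gcongr
        have hexp : exp (-(b₀ + δ) * Literature.Analysis.FluidPDE.configEnergy Z') =
            exp (-δ * Literature.Analysis.FluidPDE.configEnergy Z') *
              exp (-b₀ * Literature.Analysis.FluidPDE.configEnergy Z') := by
          rw [← Real.exp_add]
          congr 1
          ring
        have hD0 := hDsp τ s Z'
        have hAτ := hA0 τ
        calc A τ * (sqrt (b₀ + δ) ^ Fintype.card d)⁻¹ * (s * (sqrt (b₀ + δ))⁻¹ + ∑ i, ‖(Z' i).2‖) *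
              (Kτ * (Dsp τ s Z' * exp (-(b₀ + δ) * Literature.Analysis.FluidPDE.configEnergy Z')))
            = A τ * (sqrt (b₀ + δ) ^ Fintype.card d)⁻¹ *
                ((s * (sqrt (b₀ + δ))⁻¹ + ∑ i, ‖(Z' i).2‖) *
                  exp (-δ * Literature.Analysis.FluidPDE.configEnergy Z')) *
                (Kτ * (Dsp τ s Z' * exp (-b₀ * Literature.Analysis.FluidPDE.configEnergy Z'))) := by
              rw [hexp]; ring
          _ ≤ A τ * (sqrt bm ^ Fintype.card d)⁻¹ * (kmax * (sqrt bm)⁻¹ + sqrt (kmax / δ)) *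
                (Kτ * (Dsp τ s Z' * exp (-b₀ * Literature.Analysis.FluidPDE.configEnergy Z'))) := by
              gcongr
          _ = (A τ * Λ * Kτ) *
                (Dsp τ s Z' * exp (-b₀ * Literature.Analysis.FluidPDE.configEnergy Z')) := by
              rw [hΛ]; ring
      -- the transport from `τ` to `t` costs nothing
      have hAK : 0 ≤ A τ * Λ * Kτ := by
        have := hA0 τ
        positivity
      exact htr s b₀ τ t hτ0 hτ.2 (op s (R n (s + 1) τ)) (A τ * Λ * Kτ) hAK hopτ Z
    -- integrate in time
    rw [hR, ← hM t]
    set W : ℝ := Dsp t s Z * exp (-b₀ * Literature.Analysis.FluidPDE.configEnergy Z) with hW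
    have hcont : Continuous fun τ : ℝ => (A τ * Λ * (K * Λ ^ n * M τ ^ n / n !)) * W :=
      (((hAc.mul continuous_const).mul
        (((continuous_const.mul (hMc.pow n)).div_const _))).mul continuous_const)
    have hle := intervalIntegral.norm_integral_le_of_norm_le ht.1
      (Eventually.of_forall fun τ hτ => (Real.norm_eq_abs _).le.trans (hpt τ hτ Z))
      (hcont.intervalIntegrable (μ := volume) 0 t)
    rw [Real.norm_eq_abs] at hle
    refine hle.trans_eq ?_
    have hfun : (fun τ : ℝ => (A τ * Λ * (K * Λ ^ n * M τ ^ n / n !)) * W) =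
        fun τ : ℝ => (Λ * K * Λ ^ n * W) * (A τ * M τ ^ n / n !) := by
      funext τ
      ring
    rw [hfun, intervalIntegral.integral_const_mul, integral_mul_pow_primitive_div_factorial hAc hM t n]
    ring

/-- **The global chain estimate for the Duhamel terms, with a ceiling on the energy weights**
(`abs_duhamelTerm_le_dispersive` with `hop` required only for `b ≤ b_max` and
`b₀ + nδ ≤ b_max`). [cite: CIP1994, §4.5 (5.7)–(5.9)] -/
theorem abs_duhamelTerm_le_dispersive_of_le
    {transport : (s : ℕ) → ℝ → (Literature.Analysis.FluidPDE.Config s d X → ℝ) →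
      Literature.Analysis.FluidPDE.Config s d X → ℝ}
    {Dsp : ℝ → (s : ℕ) → Literature.Analysis.FluidPDE.Config s d X → ℝ}
    (hDsp : ∀ t s Z, 0 ≤ Dsp t s Z)
    (htr : ∀ (s : ℕ) (b τ t : ℝ), 0 ≤ τ → τ ≤ t →
      ∀ (g : Literature.Analysis.FluidPDE.Config s d X → ℝ) (K : ℝ), 0 ≤ K →
      (∀ Z, |g Z| ≤ K * (Dsp τ s Z * exp (-b * Literature.Analysis.FluidPDE.configEnergy Z))) →
      ∀ Z, |transport s (t - τ) g Z| ≤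
        K * (Dsp t s Z * exp (-b * Literature.Analysis.FluidPDE.configEnergy Z)))
    {op : (s : ℕ) → (Literature.Analysis.FluidPDE.Config (s + 1) d X → ℝ) →
      Literature.Analysis.FluidPDE.Config s d X → ℝ}
    {A : ℝ → ℝ} (hAc : Continuous A) (hA0 : ∀ τ, 0 ≤ A τ) {bmax : ℝ}
    (hop : ∀ (k : ℕ) (g : Literature.Analysis.FluidPDE.Config (k + 1) d X → ℝ) (K b τ : ℝ),
      0 < b → b ≤ bmax → 0 ≤ K → 0 ≤ τ →
      (∀ Z, |g Z| ≤ K * (Dsp τ (k + 1) Z * exp (-b * Literature.Analysis.FluidPDE.configEnergy Z))) →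
      ∀ Z : Literature.Analysis.FluidPDE.Config k d X, |op k g Z| ≤
        A τ * (sqrt b ^ Fintype.card d)⁻¹ * (k * (sqrt b)⁻¹ + ∑ i, ‖(Z i).2‖) *
          (K * (Dsp τ k Z * exp (-b * Literature.Analysis.FluidPDE.configEnergy Z))))
    {bm δ : ℝ} (hbm : 0 < bm) (hδ : 0 < δ) (kmax n s : ℕ) (hk : s + n ≤ kmax + 1)
    {b₀ : ℝ} (hb₀ : bm ≤ b₀) (hbmax : b₀ + n * δ ≤ bmax) {K : ℝ} (hK : 0 ≤ K)
    (F₀ : Literature.Analysis.FluidPDE.GCState d X)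
    (hF : ∀ Z : Literature.Analysis.FluidPDE.Config (s + n) d X, |F₀ (s + n) Z| ≤
      K * (Dsp 0 (s + n) Z * exp (-(b₀ + n * δ) * Literature.Analysis.FluidPDE.configEnergy Z)))
    {t : ℝ} (ht : 0 ≤ t) (Z : Literature.Analysis.FluidPDE.Config s d X) :
    |Literature.Analysis.FluidPDE.duhamelTerm transport op n s t F₀ Z| ≤
      K * ((sqrt bm ^ Fintype.card d)⁻¹ * (kmax * (sqrt bm)⁻¹ + sqrt (kmax / δ))) ^ n *
        (∫ σ in (0 : ℝ)..t, A σ) ^ n / n ! *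
        (Dsp t s Z * exp (-b₀ * Literature.Analysis.FluidPDE.configEnergy Z)) := by
  refine abs_duhamelChain_le_dispersive_of_le hDsp htr hAc hA0 hop
    (fun n s t => Literature.Analysis.FluidPDE.duhamelTerm transport op n s t F₀)
    (fun n s t Z => Literature.Analysis.FluidPDE.duhamelTerm_succ transport op n s t F₀ Z)
    ht hbm hδ kmax n s (s + n) rfl hk hb₀ hbmax hK (fun τ hτ Z => ?_) t ⟨ht, le_rfl⟩ Z
  rw [Literature.Analysis.FluidPDE.duhamelTerm_zero]
  have h := htr (s + n) (b₀ + n * δ) 0 τ le_rfl hτ.1 (F₀ (s + n)) K hK hF Z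
  rwa [sub_zero] at h

end ChainCeiling

end

end Literature.MathematicalPhysics.KineticTheory
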